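import Mathlib
import HarnessLib
import Summits.ABC.ABC.Theses.CongruentialReceptacle
import Summits.ABC.ABC.Theorems.CongruentialReceptacleQuarterWindowGivesCrux

/-!
# Crux `CompactBalanceTransfer` (stmt-ABC-1725) — depth cells are the summit (dissolution lemma)

Negative-lane / structure support written by the line lead `prover-line-stmt-ABC-1725-a1-0` (2026-08-16) for the
crux `CompactBalanceTransfer := H → ABC` of route CongruentialReceptacle, where
`H := ∀ κ > 0, ∀ ε > 0, ∃ C, ∀ abc-triples, κc ≤ a → κc ≤ b → c < C · rad(abc)^(1+ε)` is abc on every compactly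
balanced cell.

A line on this crux is a statement `S` with `S ∧ H ⊢ ABC`. The natural complement of `H` is abc on a THIN
(deep) cell `{a ≤ δ·c}` — the triples that no instance of `H` covers. This file proves that such a complement is
never below the summit, for ANY threshold `δ > 0` however small:

* `abc_of_thinCellABC` / `thinCellABC_iff_abc` : for every `δ > 0`,
  `(∀ ε > 0, ∃ C, ∀ abc-triples with a ≤ δ·c, c < C · rad(abc)^(1+ε)) ↔ ABC`;
* `minCellABC_iff_abc` : the same for the symmetric cell `min(a,b) ≤ δ·c`;
* `deepCellABC_iff_abc` : the instance `4b ≤ c` (the cell of the crux-ideator's round-2 note, one squaring);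
* `compactBalanceTransfer_of_thinCellABC` : hence every "`H` on the balanced cell + abc on the deep cell"
  decomposition of the crux proves the crux WITHOUT using `H` — it is a dissolution, not a transfer.

Mechanism (folklore power map): for an abc triple with `a ≤ b` and `n ≥ 1`, `(aⁿ, cⁿ − aⁿ, cⁿ)` is again an abc
triple (`powMap_isABCTriple`), it lies in the cell `a' ≤ 2⁻ⁿ c'`, and since `b ∣ cⁿ − aⁿ` with cofactor
`S = (cⁿ − aⁿ)/b ≤ cⁿ/b ≤ 2cⁿ⁻¹` its radical satisfies `rad' · c ≤ 2cⁿ · rad(abc)` (`rad_powMap_mul_le`). abc on the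
thin cell with exponent `1+ε'` therefore gives `(1 − (n−1)ε') log c < K + (1+ε') log rad(abc)`
(`log_bound_of_thin`), and `ε' = ε/(1 + (n−1)(1+ε))` makes the slope exactly `1+ε`. The price of depth `2⁻ⁿ` is
only the ε-multiplier `≍ n`, which the `∀ ε` absorbs: deepening is free, balancing is the whole content of the crux.

No `def`s (statements inlined); unconditional; standard axioms; no named facts.
-/

-- `Summit.<Summit>.<Problem>`: for the single-conjunct summit `ABC` the duplicate `ABC.ABC` is mandated.
set_option linter.dupNamespace false

namespace Summit.ABC.ABC.Theorems.CompactBalanceTransfer.Negative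

open Literature.NumberTheory.DiophantineGeometry
open Summit.ABC.ABC.Theses.CongruentialReceptacle
open UniqueFactorizationMonoid

/-! ### The power map `(a, b, c) ↦ (aⁿ, cⁿ − aⁿ, cⁿ)` -/

/-- The power map of an abc triple is an abc triple: for `n ≠ 0`, `aⁿ + (cⁿ − aⁿ) = cⁿ` with `0 < aⁿ < cⁿ`
(as `a < c`) and `gcd(aⁿ, cⁿ − aⁿ) = gcd(aⁿ, cⁿ) = 1` (as `gcd(a, c) = gcd(a, a + b) = gcd(a, b) = 1`). [folklore] -/
theorem powMap_isABCTriple {a b c : ℕ} (h : IsABCTriple a b c) {n : ℕ} (hn : n ≠ 0) :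
    IsABCTriple (a ^ n) (c ^ n - a ^ n) (c ^ n) := by
  obtain ⟨ha, hb, habc, hcop⟩ := h
  have hac : a < c := by omega
  have hlt : a ^ n < c ^ n := Nat.pow_lt_pow_left hac hn
  refine ⟨Nat.pow_pos ha, Nat.sub_pos_of_lt hlt, Nat.add_sub_cancel' hlt.le, ?_⟩
  have hcopac : Nat.Coprime a c := by
    rw [← habc]
    exact Nat.coprime_self_add_right.mpr hcop
  exact (Nat.coprime_sub_self_right hlt.le).mpr (Nat.Coprime.pow n n hcopac)

/-- Radical bound for the power map when the FIRST member is the small one (`a ≤ b`, so `2b ≥ c`): writing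
`cⁿ − aⁿ = b · S` (`b = c − a` divides `cⁿ − aⁿ`), one has `rad(aⁿ · bS · cⁿ) ≤ rad(S) · rad(aⁿ b cⁿ) ≤ S · rad(abc)`
and `S · c ≤ S · 2b = 2(cⁿ − aⁿ) ≤ 2cⁿ`, whence `rad(aⁿ (cⁿ − aⁿ) cⁿ) · c ≤ 2 cⁿ · rad(abc)`. [folklore] -/
theorem rad_powMap_mul_le {a b c : ℕ} (h : IsABCTriple a b c) (hab : a ≤ b) {n : ℕ} (hn : n ≠ 0) :
    rad (a ^ n) (c ^ n - a ^ n) (c ^ n) * c ≤ 2 * c ^ n * rad a b c := by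
  obtain ⟨ha, hb, habc, _⟩ := h
  have hac : a < c := by omega
  have hlt : a ^ n < c ^ n := Nat.pow_lt_pow_left hac hn
  -- `b ∣ cⁿ − aⁿ`
  have hdvd : b ∣ c ^ n - a ^ n := by
    have h := Nat.sub_dvd_pow_sub_pow c a n
    rwa [show c - a = b by omega] at h
  obtain ⟨S, hS⟩ := hdvd
  have hS0 : S ≠ 0 := by
    rintro rfl
    rw [mul_zero] at hS
    omega
  -- radical bound `rad' ≤ S · rad(abc)`
  have hrad : rad (a ^ n) (c ^ n - a ^ n) (c ^ n) ≤ S * rad a b c := by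
    rw [rad_def, rad_def, hS]
    have h0 : a * b * c ≠ 0 := mul_ne_zero (mul_ne_zero ha.ne' hb.ne') (by omega)
    have hne : (a * b * c) ^ n ≠ 0 := pow_ne_zero n h0
    have hX : a ^ n * b * c ^ n ∣ (a * b * c) ^ n := by
      rw [mul_pow, mul_pow]
      exact mul_dvd_mul (mul_dvd_mul_left _ (dvd_pow_self b hn)) dvd_rfl
    have h1 : radical (a ^ n * b * c ^ n) ∣ radical (a * b * c) := by
      have h := radical_dvd_radical hX hne
      rwa [radical_pow _ hn] at h
    have h2 : radical (a ^ n * (b * S) * c ^ n) ∣ radical S * radical (a ^ n * b * c ^ n) := by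
      have e : a ^ n * (b * S) * c ^ n = S * (a ^ n * b * c ^ n) := by ring
      rw [e]
      exact radical_mul_dvd
    have h3 : radical S ≤ S := Nat.radical_le_self_iff.mpr hS0
    calc radical (a ^ n * (b * S) * c ^ n)
        ≤ radical S * radical (a ^ n * b * c ^ n) :=
          Nat.le_of_dvd (Nat.mul_pos (Nat.radical_pos _) (Nat.radical_pos _)) h2
      _ ≤ S * radical (a * b * c) :=
          Nat.mul_le_mul h3 (Nat.le_of_dvd (Nat.radical_pos _) h1)
  -- `S · c ≤ 2 cⁿ`
  have hSc : S * c ≤ 2 * c ^ n := by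
    calc S * c ≤ S * (2 * b) := Nat.mul_le_mul_left S (by omega)
      _ = 2 * (c ^ n - a ^ n) := by rw [hS]; ring
      _ ≤ 2 * c ^ n := Nat.mul_le_mul_left 2 (Nat.sub_le _ _)
  calc rad (a ^ n) (c ^ n - a ^ n) (c ^ n) * c ≤ S * rad a b c * c := Nat.mul_le_mul_right c hrad
    _ = S * c * rad a b c := by ring
    _ ≤ 2 * c ^ n * rad a b c := Nat.mul_le_mul_right _ hSc

/-! ### One transfer step in the logarithmic abc currency -/

/-- **Core step.** Assume abc with exponent `1+ε'` and constant `C'` on the thin cell `a ≤ δ·c`, where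
`2^-(m+1) ≤ δ` and `m ε' < 1`. For an abc triple `(a, b, c)` with `a ≤ b` the power map with `n = m+1` lands in
the cell (`aⁿ ≤ (c/2)ⁿ ≤ δ cⁿ`) with radical `≤ 2cⁿ⁻¹ · rad(abc)`, so
`(m+1) log c < log(max C' 1) + (1+ε')(log 2 + m log c + log rad(abc))`, i.e.
`log c < (log(max C' 1) + (1+ε') log 2)/(1 − mε') + ((1+ε')/(1 − mε')) · log rad(abc)`. [folklore] -/
theorem log_bound_of_thin {δ ε' C' : ℝ} {m : ℕ} (hδ : (1 / 2 : ℝ) ^ (m + 1) ≤ δ) (hε' : 0 < ε')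
    (hmε' : (m : ℝ) * ε' < 1)
    (H : ∀ a b c : ℕ, IsABCTriple a b c → (a : ℝ) ≤ δ * c →
      (c : ℝ) < C' * ((rad a b c : ℕ) : ℝ) ^ (1 + ε'))
    {a b c : ℕ} (h : IsABCTriple a b c) (hab : a ≤ b) :
    Real.log (c : ℝ) < (Real.log (max C' 1) + (1 + ε') * Real.log 2) / (1 - m * ε')
      + (1 + ε') / (1 - m * ε') * Real.log ((rad a b c : ℕ) : ℝ) := by
  have hn0 : m + 1 ≠ 0 := Nat.succ_ne_zero m
  obtain ⟨ha0, hb0, habc, hcop⟩ := h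
  have hT : IsABCTriple (a ^ (m + 1)) (c ^ (m + 1) - a ^ (m + 1)) (c ^ (m + 1)) :=
    powMap_isABCTriple ⟨ha0, hb0, habc, hcop⟩ hn0
  have hR : rad (a ^ (m + 1)) (c ^ (m + 1) - a ^ (m + 1)) (c ^ (m + 1)) * c
      ≤ 2 * c ^ (m + 1) * rad a b c :=
    rad_powMap_mul_le ⟨ha0, hb0, habc, hcop⟩ hab hn0
  have haR : (0 : ℝ) < a := by exact_mod_cast ha0
  have hbR : (0 : ℝ) < b := by exact_mod_cast hb0
  have hcR : (c : ℝ) = a + b := by exact_mod_cast habc.symm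
  have hcpos : (0 : ℝ) < c := by rw [hcR]; exact add_pos haR hbR
  have habR : (a : ℝ) ≤ b := by exact_mod_cast hab
  -- the power map lies in the thin cell
  have hcell : ((a ^ (m + 1) : ℕ) : ℝ) ≤ δ * ((c ^ (m + 1) : ℕ) : ℝ) := by
    push_cast
    have h2a : (a : ℝ) ≤ 1 / 2 * c := by rw [hcR]; linarith
    calc (a : ℝ) ^ (m + 1) ≤ (1 / 2 * c) ^ (m + 1) := pow_le_pow_left₀ haR.le h2a (m + 1)
      _ = (1 / 2) ^ (m + 1) * (c : ℝ) ^ (m + 1) := by rw [mul_pow]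
      _ ≤ δ * (c : ℝ) ^ (m + 1) := mul_le_mul_of_nonneg_right hδ (by positivity)
  have hmain := H _ _ _ hT hcell
  -- radicals
  have hr0 : 0 < rad a b c := Nat.radical_pos _
  have hrpos : (0 : ℝ) < ((rad a b c : ℕ) : ℝ) := by exact_mod_cast hr0
  have hr'0 : 0 < rad (a ^ (m + 1)) (c ^ (m + 1) - a ^ (m + 1)) (c ^ (m + 1)) := Nat.radical_pos _
  have hr'pos : (0 : ℝ) < ((rad (a ^ (m + 1)) (c ^ (m + 1) - a ^ (m + 1)) (c ^ (m + 1)) : ℕ) : ℝ) := by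
    exact_mod_cast hr'0
  have hradle : ((rad (a ^ (m + 1)) (c ^ (m + 1) - a ^ (m + 1)) (c ^ (m + 1)) : ℕ) : ℝ) * c
      ≤ 2 * (c : ℝ) ^ (m + 1) * ((rad a b c : ℕ) : ℝ) := by
    exact_mod_cast hR
  -- replace `C'` by `M = max C' 1 > 0`
  set M : ℝ := max C' 1 with hM
  have hMpos : 0 < M := lt_of_lt_of_le one_pos (le_max_right _ _)
  have hXpos : 0 < ((rad (a ^ (m + 1)) (c ^ (m + 1) - a ^ (m + 1)) (c ^ (m + 1)) : ℕ) : ℝ) ^ (1 + ε') :=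
    Real.rpow_pos_of_pos hr'pos _
  have hmain' : ((c ^ (m + 1) : ℕ) : ℝ)
      < M * ((rad (a ^ (m + 1)) (c ^ (m + 1) - a ^ (m + 1)) (c ^ (m + 1)) : ℕ) : ℝ) ^ (1 + ε') :=
    lt_of_lt_of_le hmain (mul_le_mul_of_nonneg_right (le_max_left _ _) hXpos.le)
  have hcnpos : (0 : ℝ) < ((c ^ (m + 1) : ℕ) : ℝ) := by
    push_cast
    exact pow_pos hcpos _
  have hlog := Real.log_lt_log hcnpos hmain'
  rw [Real.log_mul hMpos.ne' hXpos.ne', Real.log_rpow hr'pos] at hlog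
  -- `log rad' ≤ log 2 + m log c + log rad(abc)` from `rad' · c ≤ 2 c^(m+1) rad(abc)`
  have hlogr' : Real.log ((rad (a ^ (m + 1)) (c ^ (m + 1) - a ^ (m + 1)) (c ^ (m + 1)) : ℕ) : ℝ)
      ≤ Real.log 2 + (m : ℝ) * Real.log c + Real.log ((rad a b c : ℕ) : ℝ) := by
    have h := Real.log_le_log (mul_pos hr'pos hcpos) hradle
    rw [Real.log_mul hr'pos.ne' hcpos.ne', Real.log_mul (mul_pos two_pos (pow_pos hcpos _)).ne' hrpos.ne',
      Real.log_mul two_ne_zero (pow_pos hcpos _).ne', Real.log_pow] at h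
    push_cast at h
    linarith
  have hlogcn : Real.log ((c ^ (m + 1) : ℕ) : ℝ) = ((m : ℝ) + 1) * Real.log c := by
    push_cast
    rw [Real.log_pow]
    push_cast
    ring
  rw [hlogcn] at hlog
  have h1ε : 0 < 1 - (m : ℝ) * ε' := by linarith
  have hε1 : 0 ≤ 1 + ε' := by linarith
  have hkey := mul_le_mul_of_nonneg_left hlogr' hε1
  rw [div_mul_eq_mul_div, ← add_div, lt_div_iff₀ h1ε]
  linarith

/-! ### Depth cells are the summit -/

/-- **Thin cells carry all of abc.** For every `δ > 0`: abc with exponent `1+ε` (all `ε > 0`) on the thin cell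
`a ≤ δ·c` implies abc for ALL triples. With `2^-(m+1) ≤ δ` and `ε' = ε/(1 + m(1+ε))` (so that
`(1+ε')/(1 − mε') = 1+ε`) apply the core step to the triple or to its swap. [folklore] -/
theorem abc_of_thinCellABC {δ : ℝ} (hδ : 0 < δ)
    (hD : ∀ ε : ℝ, 0 < ε → ∃ C : ℝ, ∀ a b c : ℕ, IsABCTriple a b c → (a : ℝ) ≤ δ * c →
      (c : ℝ) < C * ((rad a b c : ℕ) : ℝ) ^ (1 + ε)) :
    _root_.ABC := by
  rw [ABC_iff]
  intro ε hε
  -- depth parameter: `(1/2)^(m+1) ≤ δ`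
  obtain ⟨m, hm⟩ : ∃ m : ℕ, (1 / 2 : ℝ) ^ (m + 1) ≤ δ := by
    obtain ⟨k, hk⟩ := exists_pow_lt_of_lt_one hδ (by norm_num : (1 / 2 : ℝ) < 1)
    exact ⟨k, (pow_le_pow_of_le_one (by norm_num) (by norm_num) (Nat.le_succ k)).trans hk.le⟩
  -- exponent bookkeeping
  have hm0 : (0 : ℝ) ≤ m := Nat.cast_nonneg m
  have hden : (0 : ℝ) < 1 + m * (1 + ε) := by positivity
  set ε' : ℝ := ε / (1 + m * (1 + ε)) with hε'def
  have hε' : 0 < ε' := div_pos hε hden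
  have hmε' : (m : ℝ) * ε' < 1 := by
    rw [hε'def, ← mul_div_assoc, div_lt_one hden]
    nlinarith
  have h1m : 0 < 1 - (m : ℝ) * ε' := by linarith
  have hratio : (1 + ε') / (1 - m * ε') = 1 + ε := by
    rw [div_eq_iff h1m.ne', hε'def]
    field_simp
    ring
  obtain ⟨C', hC'⟩ := hD ε' hε'
  set K : ℝ := (Real.log (max C' 1) + (1 + ε') * Real.log 2) / (1 - m * ε') with hK
  refine ⟨Real.exp K, Real.exp_pos K, ?_⟩
  intro a b c h
  have hr0 : 0 < rad a b c := Nat.radical_pos _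
  have hrpos : (0 : ℝ) < ((rad a b c : ℕ) : ℝ) := by exact_mod_cast hr0
  have hcpos : (0 : ℝ) < c := by
    obtain ⟨ha0, -, habc, -⟩ := h
    have h0 : 0 < c := by omega
    exact_mod_cast h0
  -- logarithmic bound, by cases on which member is the small one
  have hlog : Real.log (c : ℝ) < K + (1 + ε) * Real.log ((rad a b c : ℕ) : ℝ) := by
    rcases le_total a b with hab | hba
    · have hcore := log_bound_of_thin hm hε' hmε' hC' h hab
      rw [hratio] at hcore
      exact hcore
    · have hcore := log_bound_of_thin hm hε' hmε' hC' h.swap hba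
      rw [rad_swap a b c, hratio] at hcore
      exact hcore
  calc (c : ℝ) = Real.exp (Real.log c) := (Real.exp_log hcpos).symm
    _ < Real.exp (K + (1 + ε) * Real.log ((rad a b c : ℕ) : ℝ)) := Real.exp_lt_exp.mpr hlog
    _ = Real.exp K * ((rad a b c : ℕ) : ℝ) ^ (1 + ε) := by
        rw [Real.exp_add, Real.rpow_def_of_pos hrpos, mul_comm (Real.log _)]

/-- **Depth cells are the summit (one-sided form).** For every `δ > 0`, abc restricted to the thin cell
`a ≤ δ·c` is EQUIVALENT to abc. [folklore] -/
theorem thinCellABC_iff_abc {δ : ℝ} (hδ : 0 < δ) :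
    (∀ ε : ℝ, 0 < ε → ∃ C : ℝ, ∀ a b c : ℕ, IsABCTriple a b c → (a : ℝ) ≤ δ * c →
      (c : ℝ) < C * ((rad a b c : ℕ) : ℝ) ^ (1 + ε)) ↔ _root_.ABC := by
  refine ⟨abc_of_thinCellABC hδ, fun h ε hε => ?_⟩
  obtain ⟨C, _, hC⟩ := (ABC_iff.mp h) ε hε
  exact ⟨C, fun a b c habc _ => hC a b c habc⟩

/-- **Depth cells are the summit (symmetric form).** For every `δ > 0`, abc restricted to the deep cell
`min(a, b) ≤ δ·c` — exactly the triples NOT covered by the instance `κ = δ` of the balanced hypothesis `H` — is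
EQUIVALENT to abc. [folklore] -/
theorem minCellABC_iff_abc {δ : ℝ} (hδ : 0 < δ) :
    (∀ ε : ℝ, 0 < ε → ∃ C : ℝ, ∀ a b c : ℕ, IsABCTriple a b c → ((min a b : ℕ) : ℝ) ≤ δ * c →
      (c : ℝ) < C * ((rad a b c : ℕ) : ℝ) ^ (1 + ε)) ↔ _root_.ABC := by
  constructor
  · intro hD
    refine abc_of_thinCellABC hδ fun ε hε => ?_
    obtain ⟨C, hC⟩ := hD ε hε
    refine ⟨C, fun a b c habc ha => hC a b c habc (le_trans ?_ ha)⟩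
    exact_mod_cast min_le_left a b
  · intro h ε hε
    obtain ⟨C, _, hC⟩ := (ABC_iff.mp h) ε hε
    exact ⟨C, fun a b c habc _ => hC a b c habc⟩

/-- **The quarter cell `4b ≤ c`** (the deep cell of the crux-ideator's round-2 note
`Cruxes/CompactBalanceTransfer/Obstructions-r2-k5.md`, there by one squaring split): abc on it is EQUIVALENT to
abc — the instance `δ = 1/4` of `thinCellABC_iff_abc` on the swapped triple. [folklore] -/
theorem deepCellABC_iff_abc :
    (∀ ε : ℝ, 0 < ε → ∃ C : ℝ, ∀ a b c : ℕ, IsABCTriple a b c → 4 * (b : ℝ) ≤ (c : ℝ) →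
      (c : ℝ) < C * ((rad a b c : ℕ) : ℝ) ^ (1 + ε)) ↔ _root_.ABC := by
  constructor
  · intro hD
    refine abc_of_thinCellABC (by norm_num : (0 : ℝ) < 1 / 4) fun ε hε => ?_
    obtain ⟨C, hC⟩ := hD ε hε
    refine ⟨C, fun a b c habc ha => ?_⟩
    have h := hC b a c habc.swap (by linarith)
    rwa [rad_swap a b c] at h
  · intro h ε hε
    obtain ⟨C, _, hC⟩ := (ABC_iff.mp h) ε hε
    exact ⟨C, fun a b c habc _ => hC a b c habc⟩

/-- **Every depth split of the crux is a dissolution.** abc on a thin cell `a ≤ δ·c` (any `δ > 0`) already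
proves the crux `CompactBalanceTransfer` — and the proof discards the balanced hypothesis `H`: the deep-side stub
of any "`H` on `min ≥ κc` + abc on `min ≤ κc`" line is the summit itself (`thinCellABC_iff_abc`). [folklore] -/
theorem compactBalanceTransfer_of_thinCellABC {δ : ℝ} (hδ : 0 < δ)
    (hD : ∀ ε : ℝ, 0 < ε → ∃ C : ℝ, ∀ a b c : ℕ, IsABCTriple a b c → (a : ℝ) ≤ δ * c →
      (c : ℝ) < C * ((rad a b c : ℕ) : ℝ) ^ (1 + ε)) :
    CompactBalanceTransfer :=
  fun _ => abc_of_thinCellABC hδ hD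

end Summit.ABC.ABC.Theorems.CompactBalanceTransfer.Negative
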